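import Summits.QuantumFields.BalabanUV.T4Continuum.Support.B13TermHistEnvelopeWitness
import Summits.QuantumFields.BalabanUV.T4Continuum.Support.B13TermOpEnvelope

/-!
# NE5 ∕ U3 — O2-op, CAUCHY face at activity level: NON-VACUITY WITNESS for `B13TermOpEnvelope` (one-polymer Ursell family
# `exp(o + h)` on the lineage's BASED toy model) and a NEGATIVE CONTROL on the unbased toy

Cell `pub-balaban`, unit `b2b-balaban-t4-ne5-formalise-leaf-03` (NE5 formalisation swarm, LEAF PROVER 03, gen 5; companion of the
lineage's `Support/B13TermOpEnvelope.lean` (operator Cauchy face) exactly as `B13TermHistEnvelopeWitness` p212126 (N78) is the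
companion of `B13TermHistEnvelope` p210127 (N63)).  Summits-side bookkeeping under the LEAN PLACEMENT RULE.  A TOY — nothing of
[Balaban1988RG2Cluster] is modelled; no new definition (toy objects `oneIndexing`∕`topInc`∕`toyModel` (N64), `boxModel`∕`boxClass` (N78),
`toyAct`∕`toyData` (leaf-08) are the tree's; §3's parametric-integral data are anonymous functions).  HONEST FRAMING: rung (B)+1 of the
FINITE-VOLUME T⁴ programme — NOT infinite volume, NOT a mass gap, NOT the Clay problem, NOT NE5 (NOT PRINTED; GAPS G-t4-U3-1), NOT the
wall W2-op (G-ne5p1-1′∕1″: `ActOpLineAnalyticOn` ∕ `TermOpHolomorphic (factorFamily act)` stay DISPLAYED for the (2.14) factors of [II]).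
HONEST DEPENDENCY (cell line, verbatim): continuum YM on T⁴ ⇐ BetaPertH ∧ nine spine estimates (0/9 proved); BetaPertH ⇐ (D1) ∧ (D4) ∧
CAP+tail; G-an2-4 gates asym, D1 and NE2/3/4.

WHAT.  On the based toy `boxModel` (output `exp(o + h)` as the one-polymer Ursell series, base `B̄(0,1)²`, unit margins) with the roomy
class `boxClass = B̄(0,2)²`:
* §1 `box_actOpLineAnalyticOn : ActOpLineAnalyticOn oneIndexing toyAct boxClass univ` (ζ ↦ e^{(o + ζu) + h} is entire — on ANY class);
  hence `termOpLineAnalytic_b13_of_act` fires: `TermOpLineAnalytic boxClass (term oneIndexing topInc toyAct) univ`;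
* §2 **`toy_opFibreEnvelopeCl : OpFibreEnvelopeCl boxModel univ 0 (e⁴)`** = `opFibreEnvelopeCl_b13_of_actBound` APPLIED BY NAME (`hM := rfl`)
  with N78's slack `box_boxInClass`, norm majorant `box_normMajorant` (`A ≡ e⁴`), budget `box_budget` and §1; the JOINT face
  `toy_fibreEnvelopesCl : OpFibreEnvelopeCl … ∧ HistFibreEnvelopeCl …` (`fibreEnvelopesCl_b13_of_act` with N78's `box_actExpLinearOn`) —
  the `hopF`∕`hhistF` pair of the tree's END `ne5_at_of_stepModel_fibreCl₂_scale_nat` is JOINTLY INHABITED on a non-trivial activity;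
  read back (`toy_opReading`): for `‖o₀‖, ‖h₀‖ ≤ 1`, `‖h − h₀‖ ≤ 1`, `‖u‖ ≤ 1` the map `ζ ↦ e^{(o₀ + ζu) + h}` is `DiffContOnCl` on the unit
  disc with sup `≤ e⁴` on the closed disc;
* §3 the STRUCTURAL feeders fire too: `box_factorLine : TermOpLineAnalytic boxClass (factorFamily toyAct) univ` ⟹ `ActOpLineAnalyticOn` by
  `actOpLineAnalyticOn_of_factorLine`; and **`box_factorHolomorphic : TermOpHolomorphic boxClass (factorFamily toyAct) univ μ f 𝒪`** with
  `μ ≡` Dirac on `Unit`, `f ≡ e^{o}·e^{h}`, `𝒪 ≡ univ` (every clause with explicit data; local domination on `ball o₀ 1` by `e^{‖o₀‖+1}·e²`)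
  ⟹ `ActOpLineAnalyticOn` by `actOpLineAnalyticOn_of_factorHolomorphic` and `OpFibreEnvelopeCl boxModel univ 0 (e⁴)` through the WHOLE chain
  (`toy_opFibreEnvelopeCl_structural`);
* §4 NEGATIVE CONTROL: on the UNBASED toy `toyModel` (`Base := univ`) the conclusion `OpFibreEnvelopeCl toyModel univ 0 G` is FALSE for
  every `G` (base point `p = (G + 1, 0)`, `h = 0`, `u = 0`, `ζ = 0`: `‖e^{G+1}‖ > G`) although `ActOpLineAnalyticOn` holds there on every
  class — the slack∕majorant binders carry the content, as for the history face (N78: `¬ BoxInClass toyModel boxClass univ`).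
0 sorry; axioms ⊆ {propext, Classical.choice, Quot.sound}.
-/

noncomputable section

open MeasureTheory Metric Set
open scoped BigOperators

namespace Summit.QuantumFields.BalabanUV.T4Continuum.B13TermOpEnvelopeWitness

open Literature.MathematicalPhysics.QuantumFieldTheory.Balaban1983to89.T4OutputRate (Carriers)
open Literature.MathematicalPhysics.QuantumFieldTheory.Balaban1983to89.T4InputCauchyRate (toyCarriers)
open Literature.MathematicalPhysics.QuantumFieldTheory.Balaban1983to89.T4InputCauchyRateData (StepModel)
open Literature.MathematicalPhysics.QuantumFieldTheory.Balaban1983to89.T4InputCauchyRateTermwise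
  (TermOpLineAnalytic OpFibreEnvelopeCl HistFibreEnvelopeCl)
open Summit.QuantumFields.BalabanUV.T4Continuum.B13StepTermFamily (term toyAct toyData)
open Summit.QuantumFields.BalabanUV.T4Continuum.B13TermHistSecantWitness (oneIndexing topInc toyModel)
open Summit.QuantumFields.BalabanUV.T4Continuum.B13TermHistEnvelopeWitness
  (boxModel boxClass mem_boxClass box_boxInClass box_actExpLinearOn box_normMajorant box_budget out_eq)
open Summit.QuantumFields.BalabanUV.T4Continuum.OutputRateOpHolomorphic (TermOpHolomorphic)
open Summit.QuantumFields.BalabanUV.T4Continuum.B13TermOpEnvelope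

/-! ## §1 Factor line analyticity on the toy (any class) and the term-level consequence -/

/-- [folklore] `ActOpLineAnalyticOn` holds for the toy activity on EVERY class: `ζ ↦ e^{(o + ζu) + h}` is entire. -/
theorem toy_actOpLineAnalyticOn (K : ℕ → (ℕ → ℝ) → toyCarriers.BgB → Set (ℂ × ℂ)) (W : Set (ℕ → ℝ)) :
    ActOpLineAnalyticOn oneIndexing toyAct K W := by
  intro k g _ U o u h _ X _ i _ m
  show DifferentiableOn ℂ (fun ζ : ℂ => Complex.exp (o + ζ • u + h)) (closedBall 0 1)
  exact ((((differentiable_id.smul_const u).const_add o).add_const h).cexp).differentiableOn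

/-- [folklore] In particular on the roomy class of the based toy. -/
theorem box_actOpLineAnalyticOn : ActOpLineAnalyticOn oneIndexing toyAct boxClass Set.univ :=
  toy_actOpLineAnalyticOn boxClass Set.univ

/-- [folklore] §1 of `B13TermOpEnvelope` FIRES: the toy's Ursell terms are operator-line analytic on the roomy class. -/
theorem box_termOpLineAnalytic : TermOpLineAnalytic boxClass (term oneIndexing topInc toyAct) Set.univ :=
  termOpLineAnalytic_b13_of_act (inc := topInc) box_actOpLineAnalyticOn

/-! ## §2 The operator Cauchy face fires BY NAME; the joint face; the conclusion read back -/

/-- [folklore] **THE OPERATOR CAUCHY PRODUCER FIRES ON THE BASED TOY**: slack (N78 `box_boxInClass`) + norm majorant `A ≡ e⁴`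
(`box_normMajorant`) + per-domain budget `e⁴` at rate `0` (`box_budget`) + factor line analyticity (§1) ⟹ `OpFibreEnvelopeCl boxModel univ 0 (e⁴)`
— `opFibreEnvelopeCl_b13_of_actBound` with `hM := rfl`, every binder discharged by explicit data. -/
theorem toy_opFibreEnvelopeCl : OpFibreEnvelopeCl boxModel Set.univ 0 (Real.exp 4) :=
  opFibreEnvelopeCl_b13_of_actBound oneIndexing topInc toyAct (M := boxModel) (fun _ _ _ _ => rfl) box_boxInClass box_normMajorant
    box_budget box_actOpLineAnalyticOn

/-- [folklore] **THE JOINT FACE FIRES**: `OpFibreEnvelopeCl ∧ HistFibreEnvelopeCl` for the based toy from ONE majorant∕budget, §1 and N78's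
structure `box_actExpLinearOn` — the `hopF`∕`hhistF` pair of `ne5_at_of_stepModel_fibreCl₂_scale_nat` is jointly inhabited. -/
theorem toy_fibreEnvelopesCl :
    OpFibreEnvelopeCl boxModel Set.univ 0 (Real.exp 4) ∧ HistFibreEnvelopeCl boxModel Set.univ 0 (Real.exp 4) :=
  fibreEnvelopesCl_b13_of_act oneIndexing topInc toyAct (M := boxModel) (D := toyData) (fun _ _ _ _ => rfl) box_boxInClass
    box_normMajorant box_budget box_actOpLineAnalyticOn box_actExpLinearOn

/-- [folklore] **READING THE CONCLUSION** (non-triviality): for a base point `‖o₀‖, ‖h₀‖ ≤ 1`, a history datum `‖h − h₀‖ ≤ 1` and an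
operator direction `‖u‖ ≤ 1`, the operator fibre map `ζ ↦ e^{(o₀ + ζ•u) + h}` is complex-differentiable on the open unit disc, continuous
up to the boundary, and bounded by `e⁴` on the closed disc. -/
theorem toy_opReading {o₀ h₀ h u : ℂ} (ho₀ : ‖o₀‖ ≤ 1) (hh₀ : ‖h₀‖ ≤ 1) (hh : ‖h - h₀‖ ≤ 1) (hu : ‖u‖ ≤ 1) :
    DiffContOnCl ℂ (fun ζ : ℂ => Complex.exp (o₀ + ζ • u + h)) (ball 0 1) ∧
      ∀ ζ ∈ closedBall (0 : ℂ) 1, ‖Complex.exp (o₀ + ζ • u + h)‖ ≤ Real.exp 4 := by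
  have hp : ((o₀, h₀) : ℂ × ℂ) ∈ boxModel.Base 0 (fun _ => 0) () :=
    Set.mk_mem_prod (mem_closedBall_zero_iff.2 ho₀) (mem_closedBall_zero_iff.2 hh₀)
  have hhB : h ∈ closedBall ((o₀, h₀) : ℂ × ℂ).2 (boxModel.rHist 0) := by
    rw [mem_closedBall, dist_eq_norm]; exact hh
  have huB : ‖u‖ ≤ boxModel.rOp 0 := hu
  have key := toy_opFibreEnvelopeCl 0 (fun _ => 0) (Set.mem_univ _) () (o₀, h₀) hp (0 : ℕ) rfl h hhB u huB
  have hd : toyCarriers.d (0 : ℕ) = 0 := rfl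
  simp only [out_eq (k := 0) (X := (0 : ℕ)) rfl, hd, mul_zero, neg_zero, Real.exp_zero, mul_one] at key
  exact key

/-! ## §3 The structural feeders fire: factor family line-analytic ∕ dominated holomorphic integral -/

/-- [folklore] The tree's `TermOpLineAnalytic` AT THE FACTOR FAMILY of the toy activity, on any class (entire). -/
theorem toy_factorLine (K : ℕ → (ℕ → ℝ) → toyCarriers.BgB → Set (ℂ × ℂ)) (W : Set (ℕ → ℝ)) :
    TermOpLineAnalytic K (factorFamily toyAct) W := by
  intro k g _ U o u h _ X _ zj
  show DifferentiableOn ℂ (fun ζ : ℂ => Complex.exp (o + ζ • u + h)) (closedBall 0 1)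
  exact ((((differentiable_id.smul_const u).const_add o).add_const h).cexp).differentiableOn

/-- [folklore] … hence `ActOpLineAnalyticOn` by `actOpLineAnalyticOn_of_factorLine` (first feeder fires). -/
theorem box_actOpLineAnalyticOn_of_factorLine : ActOpLineAnalyticOn oneIndexing toyAct boxClass Set.univ :=
  actOpLineAnalyticOn_of_factorLine oneIndexing (toy_factorLine boxClass Set.univ)

/-- [folklore] **THE OWNER's STRUCTURAL SHAPE AT THE FACTOR FAMILY IS INHABITED**: `TermOpHolomorphic boxClass (factorFamily toyAct) univ μ f 𝒪`
with `μ ≡` the Dirac mass on `Unit`, integrand `(h, o, a) ↦ e^{o}·e^{h}`, operator domain `univ` — class section `⊆ univ`; measurability of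
a constant; `o ↦ e^{o}·e^{h}` entire; LOCAL domination on `ball o₀ 1` by `e^{‖o₀‖+1}·e²` (`‖h‖ ≤ 2` on the class); representation
`e^{o+h} = ∫ e^{o}e^{h} dδ`. -/
theorem box_factorHolomorphic :
    TermOpHolomorphic boxClass (factorFamily toyAct) Set.univ (α := fun _ _ => Unit) (fun _ _ _ _ => Measure.dirac ())
      (fun _ _ h _ o _ => Complex.exp o * Complex.exp h) fun _ _ _ _ => Set.univ := by
  intro k g _ U h hex
  obtain ⟨o₁, ho₁⟩ := hex
  obtain ⟨-, hh2⟩ := mem_boxClass ho₁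
  dsimp only
  refine ⟨fun _ _ => mem_univ _, fun X _ zj => ⟨fun _ _ => aestronglyMeasurable_const,
    Filter.Eventually.of_forall fun _ => (Complex.differentiable_exp.mul_const _).differentiableOn, fun o₀ _ => ?_,
    fun o _ => ?_⟩⟩
  · refine ⟨1, one_pos, subset_univ _, fun _ => Real.exp (‖o₀‖ + 1) * Real.exp 2, integrable_const _,
      Filter.Eventually.of_forall fun _ o ho => ?_⟩
    rw [mem_ball, dist_eq_norm] at ho
    rw [norm_mul, Complex.norm_exp, Complex.norm_exp]
    refine mul_le_mul (Real.exp_le_exp.2 ?_) (Real.exp_le_exp.2 ((Complex.re_le_norm _).trans hh2)) (Real.exp_pos _).le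
      (Real.exp_pos _).le
    calc o.re ≤ ‖o‖ := Complex.re_le_norm o
      _ = ‖(o - o₀) + o₀‖ := by rw [sub_add_cancel]
      _ ≤ ‖o - o₀‖ + ‖o₀‖ := norm_add_le _ _
      _ ≤ ‖o₀‖ + 1 := by linarith
  · show Complex.exp (o + h) = ∫ _ : Unit, Complex.exp o * Complex.exp h ∂(Measure.dirac ())
    rw [integral_dirac, Complex.exp_add]

/-- [folklore] … hence `ActOpLineAnalyticOn` by `actOpLineAnalyticOn_of_factorHolomorphic` (second feeder fires: the OWNER's
`termOpLineAnalytic_of_opHolomorphic` at the factor family). -/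
theorem box_actOpLineAnalyticOn_of_factorHolomorphic : ActOpLineAnalyticOn oneIndexing toyAct boxClass Set.univ :=
  actOpLineAnalyticOn_of_factorHolomorphic oneIndexing box_factorHolomorphic

/-- [folklore] **THE WHOLE OPERATOR CAUCHY CHAIN FIRES**: `TermOpHolomorphic (factorFamily toyAct)` + slack + majorant + budget ⟹
`OpFibreEnvelopeCl boxModel univ 0 (e⁴)` by `opFibreEnvelopeCl_b13_of_factorHolomorphic`. -/
theorem toy_opFibreEnvelopeCl_structural : OpFibreEnvelopeCl boxModel Set.univ 0 (Real.exp 4) :=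
  opFibreEnvelopeCl_b13_of_factorHolomorphic oneIndexing topInc toyAct (M := boxModel) (fun _ _ _ _ => rfl) box_boxInClass
    box_normMajorant box_budget box_factorHolomorphic

/-! ## §4 Negative control: without a bounded base the envelope fails although the factors are line-analytic -/

/-- [folklore] **THE ENVELOPE NEEDS THE SLACK∕MAJORANT, NOT ONLY LINE ANALYTICITY**: on the lineage's unbased toy `toyModel` (`Base := univ`,
unit margins; `ActOpLineAnalyticOn` holds there on every class by `toy_actOpLineAnalyticOn`) the conclusion `OpFibreEnvelopeCl toyModel univ 0 G`
is FALSE for EVERY `G`: at the base point `p = (G + 1, 0)`, history `h = 0`, direction `u = 0`, `ζ = 0` the output is `e^{G+1} > G`. -/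
theorem not_opFibreEnvelopeCl_toyModel (G : ℝ) : ¬ OpFibreEnvelopeCl toyModel Set.univ 0 G := by
  intro henv
  have hp : ((((G + 1 : ℝ) : ℂ)), (0 : ℂ)) ∈ toyModel.Base 0 (fun _ => 0) () := Set.mem_univ _
  have hh : (0 : ℂ) ∈ closedBall ((((G + 1 : ℝ) : ℂ), (0 : ℂ)) : ℂ × ℂ).2 (toyModel.rHist 0) := by
    show (0 : ℂ) ∈ closedBall (0 : ℂ) 1
    exact mem_closedBall_self zero_le_one
  have hu : ‖(0 : ℂ)‖ ≤ toyModel.rOp 0 := by rw [norm_zero]; exact (toyModel.rOp_pos 0).le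
  have key := (henv 0 (fun _ => 0) (Set.mem_univ _) () _ hp (0 : ℕ) rfl 0 hh 0 hu).2 0 (mem_closedBall_self zero_le_one)
  have hd : toyCarriers.d (0 : ℕ) = 0 := rfl
  rw [B13TermHistSecantWitness.out_eq (k := 0) (X := (0 : ℕ)) rfl, hd, mul_zero, neg_zero, Real.exp_zero, mul_one] at key
  change ‖Complex.exp (((G + 1 : ℝ) : ℂ) + (0 : ℂ) • (0 : ℂ) + 0)‖ ≤ G at key
  rw [smul_zero, add_zero, add_zero, Complex.norm_exp, Complex.ofReal_re] at key
  linarith [Real.add_one_le_exp (G + 1)]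

end Summit.QuantumFields.BalabanUV.T4Continuum.B13TermOpEnvelopeWitness

end
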